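import Summits.Ventures.PercRepro.S1NineSixSevenElevenComplements

/-!
# PercRepro — THE FIRST `(9, 6)` SHAPE: `(rank 7 on 11) ⊕ U_{2,4}` AT `(9, 4)` (p2, gen 28; SUBCLAIM-S1 §6.10
(xvii)(q); PARTIAL — towards the `(9, 6)` capstone)

`M` coloop-free of rank `7` on `11` points with all pairs of rank `2`, `N` a `4`-point line. `#U ≤ s₇ + 4 (q₃ + s₈) +
6 (q₂ + t + s₉)`, `#Y ≥ 11 f(3) + 15 f(4) + 16 f(5) + 16 f(6) + 5 f(7)`; with the rank profile by sizes, the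
partitions (both directions), the incidence bounds `3t ≤ 165`, `6q₂ ≤ 165`, `10p₅ ≤ 55`, the fourteen up/down kills
and the plane bound `q₃ ≤ r₃₃`: `Φ(9, 4) · #U ≤ #Y` (linarith). Nothing is claimed about any cell.

* `consumer_arith_line_four_seven_eleven`, `c025_nine_four_disjointSum_seven_eleven_line_four`.
Axioms: standard.
-/

open scoped Matroid

namespace PercRepro

namespace S1

open Set

variable {α : Type}

/-- The arithmetic of `(rank 7 on 11) ⊕ U_{2,4}` at `(9, 4)` (exactly the hypotheses linarith uses). -/
theorem consumer_arith_line_four_seven_eleven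
    {u y t q2 p5 r33 r43 r44 r53 r54 r55 r63 r64 r65 r66 r74 r75 r76 r77 r85 r86 r87 r96 r97 r107 F3 F4 F5 F6 F7 : ℚ}
    (hU : u ≤ r77 + 4 * (r43 + r87) + 6 * (q2 + t + r97))
    (hY : 11 * F3 + 15 * F4 + 16 * F5 + 16 * F6 + 5 * F7 ≤ y)
    (hF3 : r33 + r43 + r53 + r63 ≤ F3) (hF4 : r44 + r54 + r64 + r74 ≤ F4) (hF5 : r55 + r65 + r75 + r85 ≤ F5)
    (hF6 : r66 + r76 + r86 + r96 ≤ F6) (hF7 : 1 + r107 + r97 + r87 + r77 ≤ F7)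
    (h4 : 330 ≤ q2 + r43 + r44) (h5 : 462 ≤ p5 + r53 + r54 + r55) (h6 : 462 ≤ r63 + r64 + r65 + r66)
    (h10 : 11 ≤ r107) (h3' : t + r33 ≤ 165) (h7' : r74 + r75 + r76 + r77 ≤ 330) (h8' : r85 + r86 + r87 ≤ 165)
    (h9' : r96 + r97 ≤ 55) (ht : 3 * t ≤ 3 * 55) (hq2 : 6 * q2 ≤ 3 * 55) (hp5 : 10 * p5 ≤ 1 * 55)
    (u43 : 7 * (q2 + r43) ≤ 5 * (p5 + r53 + r54)) (u54 : 6 * (p5 + r53 + r54) ≤ 6 * (r63 + r64 + r65))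
    (u65 : 5 * (r63 + r64 + r65) ≤ 7 * (r74 + r75 + r76)) (d74 : 7 * r74 ≤ 5 * (r63 + r64))
    (d64 : 6 * (r63 + r64) ≤ 6 * (p5 + r53 + r54)) (d53 : 5 * (p5 + r53) ≤ 7 * (q2 + r43))
    (d63 : 6 * r63 ≤ 6 * (p5 + r53)) (plane : r43 ≤ r33) (n18 : 0 ≤ r85) (n19 : 0 ≤ r86) (n21 : 0 ≤ r96) :
    42 / 5 * u ≤ y := by
  linarith

/-- **`M ⊕ U_{2,4}` at `(9, 4)`**: `M` coloop-free of rank `7` on `11` points with all pairs of rank `2`, `N` a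
`4`-point line (rank `2`, `4` points, all pairs of rank `2`). -/
theorem c025_nine_four_disjointSum_seven_eleven_line_four (M N : Matroid α) [M.Finite] [N.Finite]
    (h : Disjoint M.E N.E) (hM : M.eRank = ((7 : ℕ) : ℕ∞)) (hME : M.E.ncard = 11) (hcolM : M.coloops = ∅)
    (hpairsM : ∀ e ∈ M.E, ∀ f ∈ M.E, e ≠ f → M.eRk {e, f} = 2) (hN : N.eRank = ((2 : ℕ) : ℕ∞))
    (hNE : N.E.ncard = 4) (hpairsN : ∀ e ∈ N.E, ∀ f ∈ N.E, e ≠ f → N.eRk {e, f} = 2) :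
    phiK 9 4 * ({A : Set α | A ⊆ (M.disjointSum N h).E ∧ (M.disjointSum N h).eRk A = ((9 : ℕ) : ℕ∞) ∧
        (M.disjointSum N h).eRk ((M.disjointSum N h).E \ A) = ((4 : ℕ) : ℕ∞)}.ncard : ℚ) ≤
      ({A : Set α | A ⊆ (M.disjointSum N h).E ∧ ((4 : ℕ) : ℕ∞) < (M.disjointSum N h).eRk A ∧
        (M.disjointSum N h).eRk A < ((9 : ℕ) : ℕ∞)}.ncard : ℚ) := by
  obtain ⟨h74, h73, h72⟩ := complements_rank_seven_eleven (M := M) hME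
  -- the `U`-side: the slices `(7, 2)`, `(7, 3)`, `(7, 4)`
  have hU : {A : Set α | A ⊆ (M.disjointSum N h).E ∧ (M.disjointSum N h).eRk A = ((9 : ℕ) : ℕ∞) ∧
      (M.disjointSum N h).eRk ((M.disjointSum N h).E \ A) = ((4 : ℕ) : ℕ∞)}.ncard ≤
      (rkSets M 7 7).ncard + 4 * ((rkSets M 4 3).ncard + (rkSets M 8 7).ncard) +
        6 * ((rankTwoSets M 4).ncard + (rankTwoSets M 3).ncard + (rkSets M 9 7).ncard) := by
    rw [disjointSum_ncard_U_eq_finsum M N h 9 4, finsum_mem_coe_finset]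
    have hsub : ({(7, 2), (7, 3), (7, 4)} : Finset (ℕ × ℕ)) ⊆ Finset.range (9 + 1) ×ˢ Finset.range (4 + 1) := by
      decide
    rw [← Finset.sum_subset hsub ?_]
    · rw [Finset.sum_insert (by decide), Finset.sum_insert (by decide), Finset.sum_singleton]
      dsimp only
      show (profileSet M 7 2).ncard * (profileSet N 2 2).ncard + ((profileSet M 7 3).ncard * (profileSet N 2 1).ncard +
        (profileSet M 7 4).ncard * (profileSet N 2 0).ncard) ≤ _
      have g22 := ncard_profileSet_le_choose_of_ncard_eq (N := N) (a := 2) (b := 2) hNE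
      rw [show Nat.choose (2 + 2) 2 = 6 by decide] at g22
      have g21 := ncard_profileSet_top_one_le_of_pairs' hpairsN 2
      rw [hNE] at g21
      have g20 := ncard_profileSet_top_zero_le_of_pairs N hpairsN (by omega) 2
      have e1 := Nat.mul_le_mul h72 g22
      have e2 := Nat.mul_le_mul h73 g21
      have e3 := Nat.mul_le_mul h74 g20
      linarith [e1, e2, e3]
    · rintro ⟨a, b⟩ hmem hnot
      rw [Finset.mem_product, Finset.mem_range, Finset.mem_range] at hmem
      simp only [Finset.mem_insert, Finset.mem_singleton, Prod.mk.injEq, not_or] at hnot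
      dsimp only
      rcases Nat.lt_or_ge 7 a with ha | ha
      · rw [profileSet_eq_empty_of_eRank_lt M hM ha b, ncard_empty, zero_mul]
      rcases Nat.lt_or_ge a 7 with ha' | ha'
      · have h9a : 2 < 9 - a := by omega
        rw [profileSet_eq_empty_of_eRank_lt N hN h9a (4 - b), ncard_empty, mul_zero]
      have ha7 : a = 7 := by omega
      subst ha7
      rw [show (9 : ℕ) - 7 = 2 from rfl]
      have hb : b < 2 := by omega
      have hb' : 2 < 4 - b := by omega
      rw [profileSet_eq_empty_of_eRank_lt_snd N hN hb' 2, ncard_empty, mul_zero]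
  -- the `Y`-side: eleven slices
  have hY : 11 * (rankSet M 3).ncard + 15 * (rankSet M 4).ncard + 16 * (rankSet M 5).ncard +
      16 * (rankSet M 6).ncard + 5 * (rankSet M 7).ncard ≤
      {A : Set α | A ⊆ (M.disjointSum N h).E ∧ ((4 : ℕ) : ℕ∞) < (M.disjointSum N h).eRk A ∧
        (M.disjointSum N h).eRk A < ((9 : ℕ) : ℕ∞)}.ncard := by
    rw [disjointSum_ncard_Y_eq_finsum M N h 9 4, finsum_mem_coe_finset]
    have hsub : ({(3, 2), (4, 1), (4, 2), (5, 0), (5, 1), (5, 2), (6, 0), (6, 1), (6, 2), (7, 0), (7, 1)} :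
        Finset (ℕ × ℕ)) ⊆ (Finset.range 9 ×ˢ Finset.range 9).filter (fun x : ℕ × ℕ => 4 < x.1 + x.2 ∧ x.1 + x.2 < 9) := by
      decide
    refine le_trans ?_ (Finset.sum_le_sum_of_subset hsub)
    rw [Finset.sum_insert (by decide), Finset.sum_insert (by decide), Finset.sum_insert (by decide),
      Finset.sum_insert (by decide), Finset.sum_insert (by decide), Finset.sum_insert (by decide),
      Finset.sum_insert (by decide), Finset.sum_insert (by decide), Finset.sum_insert (by decide),
      Finset.sum_insert (by decide), Finset.sum_singleton]
    dsimp only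
    have G0 : 1 ≤ (rankSet N 0).ncard := by
      have h0 : (∅ : Set α) ∈ rankSet N 0 := ⟨empty_subset _, by rw [N.eRk_empty]; rfl⟩
      exact (ncard_pos (rankSet_finite N 0)).mpr ⟨∅, h0⟩
    have G1 : 4 ≤ (rankSet N 1).ncard := by
      have := ncard_le_ncard_rankSet_one_of_pairs hpairsN (by omega)
      rwa [hNE] at this
    have G2 : 11 ≤ (rankSet N 2).ncard := by
      have := ncard_rankSet_two_ge_of_rank_two N hN hpairsN
      rwa [hNE, show 2 ^ 4 - 1 - 4 = 11 by decide] at this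
    have e32 := Nat.mul_le_mul_left (rankSet M 3).ncard G2
    have e41 := Nat.mul_le_mul_left (rankSet M 4).ncard G1
    have e42 := Nat.mul_le_mul_left (rankSet M 4).ncard G2
    have e50 := Nat.mul_le_mul_left (rankSet M 5).ncard G0
    have e51 := Nat.mul_le_mul_left (rankSet M 5).ncard G1
    have e52 := Nat.mul_le_mul_left (rankSet M 5).ncard G2
    have e60 := Nat.mul_le_mul_left (rankSet M 6).ncard G0
    have e61 := Nat.mul_le_mul_left (rankSet M 6).ncard G1
    have e62 := Nat.mul_le_mul_left (rankSet M 6).ncard G2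
    have e70 := Nat.mul_le_mul_left (rankSet M 7).ncard G0
    have e71 := Nat.mul_le_mul_left (rankSet M 7).ncard G1
    linarith
  -- the profile of `M`
  obtain ⟨hF3, hF4, hF5, hF6, hF7⟩ := f_ge_rank_seven_eleven hM hME hcolM hpairsM
  obtain ⟨-, h4, h5, h6, -, -, -, h10⟩ := rank_classes_eleven hM hME hcolM hpairsM
  obtain ⟨h3', -, -, -, h7', h8', h9', -⟩ := rank_classes_eleven_le' hM hME hcolM
  have hcl : ∀ x ∈ M.E, ∀ y ∈ M.E, x ≠ y → (M.closure {x, y}).ncard ≤ 3 + 2 := by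
    intro x hx y hy hxy
    have := ncard_closure_pair_le_of_coloops' M hM (by norm_num) hcolM hpairsM hx hy hxy
    rw [hME] at this
    omega
  have ht := choose_mul_ncard_rankTwoSets_le M hpairsM (c := 3) (m := 3) hcl
  have hq2 := choose_mul_ncard_rankTwoSets_le M hpairsM (c := 3) (m := 4) hcl
  have hp5 := choose_mul_ncard_rankTwoSets_le M hpairsM (c := 3) (m := 5) hcl
  rw [hME, show Nat.choose 3 2 = 3 by decide, show Nat.choose 3 (3 - 2) = 3 by decide,
    show Nat.choose 11 2 = 55 by decide] at ht
  rw [hME, show Nat.choose 4 2 = 6 by decide, show Nat.choose 3 (4 - 2) = 3 by decide,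
    show Nat.choose 11 2 = 55 by decide] at hq2
  rw [hME, show Nat.choose 5 2 = 10 by decide, show Nat.choose 3 (5 - 2) = 1 by decide,
    show Nat.choose 11 2 = 55 by decide] at hp5
  have u43 := kill_up_4_3 (M := M) hME hpairsM
  have u54 := kill_up_5_4 (M := M) hME hpairsM
  have u65 := kill_up_6_5 (M := M) hME hpairsM
  have d74 := kill_down_6_4 (M := M) hME hpairsM
  have d64 := kill_down_5_4 (M := M) hME hpairsM
  have d53 := kill_down_4_3 (M := M) hME hpairsM
  have d63 := kill_down_5_3 (M := M) hME hpairsM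
  have plane := ncard_rkSets_four_three_le hpairsM (rank_three_triples_closure_le_six hM hME hcolM)
  have z6 : (rankTwoSets M 6).ncard = 0 := by
    rw [rankTwoSets_eq_empty_of_big_eleven hM hME hcolM (k := 6) (by norm_num), ncard_empty]
  have z7 : (rankTwoSets M 7).ncard = 0 := by
    rw [rankTwoSets_eq_empty_of_big_eleven hM hME hcolM (k := 7) (by norm_num), ncard_empty]
  have z73 : (rkSets M 7 3).ncard = 0 := by
    rw [rkSets_eq_empty_of_big_eleven hM hME hcolM (k := 7) (n := 3) (by norm_num) (by norm_num), ncard_empty]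
  rw [z6] at u54 u65 d74 d64 d63
  rw [z7, z73] at u65 d74
  simp only [zero_add] at u54 u65 d74 d64 d63
  rw [phiK_nine_four]
  generalize hu0 : {A : Set α | A ⊆ (M.disjointSum N h).E ∧ (M.disjointSum N h).eRk A = ((9 : ℕ) : ℕ∞) ∧
      (M.disjointSum N h).eRk ((M.disjointSum N h).E \ A) = ((4 : ℕ) : ℕ∞)}.ncard = u at hU ⊢
  generalize hy0 : {A : Set α | A ⊆ (M.disjointSum N h).E ∧ ((4 : ℕ) : ℕ∞) < (M.disjointSum N h).eRk A ∧
      (M.disjointSum N h).eRk A < ((9 : ℕ) : ℕ∞)}.ncard = y at hY ⊢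
  generalize (rankTwoSets M 3).ncard = t at *
  generalize (rankTwoSets M 4).ncard = q2 at *
  generalize (rankTwoSets M 5).ncard = p5 at *
  generalize (rankTwoSets M 6).ncard = t6 at *
  generalize (rankTwoSets M 7).ncard = t7 at *
  generalize (rankTwoSets M 8).ncard = t8 at *
  generalize (rankTwoSets M 9).ncard = t9 at *
  generalize (rkSets M 3 3).ncard = r33 at *
  generalize (rkSets M 4 3).ncard = r43 at *
  generalize (rkSets M 4 4).ncard = r44 at *
  generalize (rkSets M 5 3).ncard = r53 at *
  generalize (rkSets M 5 4).ncard = r54 at *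
  generalize (rkSets M 5 5).ncard = r55 at *
  generalize (rkSets M 6 3).ncard = r63 at *
  generalize (rkSets M 6 4).ncard = r64 at *
  generalize (rkSets M 6 5).ncard = r65 at *
  generalize (rkSets M 6 6).ncard = r66 at *
  generalize (rkSets M 7 3).ncard = r73 at *
  generalize (rkSets M 7 4).ncard = r74 at *
  generalize (rkSets M 7 5).ncard = r75 at *
  generalize (rkSets M 7 6).ncard = r76 at *
  generalize (rkSets M 7 7).ncard = r77 at *
  generalize (rkSets M 8 5).ncard = r85 at *
  generalize (rkSets M 8 6).ncard = r86 at *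
  generalize (rkSets M 8 7).ncard = r87 at *
  generalize (rkSets M 9 6).ncard = r96 at *
  generalize (rkSets M 9 7).ncard = r97 at *
  generalize (rkSets M 10 7).ncard = r107 at *
  generalize (rankSet M 3).ncard = f3 at *
  generalize (rankSet M 4).ncard = f4 at *
  generalize (rankSet M 5).ncard = f5 at *
  generalize (rankSet M 6).ncard = f6 at *
  generalize (rankSet M 7).ncard = f7 at *
  exact consumer_arith_line_four_seven_eleven (u := (u : ℚ)) (y := (y : ℚ)) (t := (t : ℚ)) (q2 := (q2 : ℚ))
    (p5 := (p5 : ℚ)) (r33 := (r33 : ℚ)) (r43 := (r43 : ℚ)) (r44 := (r44 : ℚ)) (r53 := (r53 : ℚ)) (r54 := (r54 : ℚ))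
    (r55 := (r55 : ℚ)) (r63 := (r63 : ℚ)) (r64 := (r64 : ℚ)) (r65 := (r65 : ℚ)) (r66 := (r66 : ℚ)) (r74 := (r74 : ℚ))
    (r75 := (r75 : ℚ)) (r76 := (r76 : ℚ)) (r77 := (r77 : ℚ)) (r85 := (r85 : ℚ)) (r86 := (r86 : ℚ)) (r87 := (r87 : ℚ))
    (r96 := (r96 : ℚ)) (r97 := (r97 : ℚ)) (r107 := (r107 : ℚ)) (F3 := (f3 : ℚ)) (F4 := (f4 : ℚ)) (F5 := (f5 : ℚ))
    (F6 := (f6 : ℚ)) (F7 := (f7 : ℚ)) (by exact_mod_cast hU) (by exact_mod_cast hY) (by exact_mod_cast hF3)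
    (by exact_mod_cast hF4) (by exact_mod_cast hF5) (by exact_mod_cast hF6) (by exact_mod_cast hF7)
    (by exact_mod_cast h4) (by exact_mod_cast h5) (by exact_mod_cast h6) (by exact_mod_cast h10)
    (by exact_mod_cast h3') (by exact_mod_cast h7') (by exact_mod_cast h8') (by exact_mod_cast h9')
    (by exact_mod_cast ht) (by exact_mod_cast hq2) (by exact_mod_cast hp5) (by exact_mod_cast u43)
    (by exact_mod_cast u54) (by exact_mod_cast u65) (by exact_mod_cast d74) (by exact_mod_cast d64)
    (by exact_mod_cast d53) (by exact_mod_cast d63) (by exact_mod_cast plane) (Nat.cast_nonneg r85)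
    (Nat.cast_nonneg r86) (Nat.cast_nonneg r96)

end S1

end PercRepro
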